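import Literature.Analysis.DeBrangesSpaces.BurnolSonineEvaluatorJump
import HarnessLib

/-!
# Burnol 2002 (CRAS 335), Théorème 8, clauses (i)–(ii): the integral in the printed formula for `ℰ_λ`
# converges absolutely on `Re w > 0`, and `ℰ_λ` IS an entire function — non-vacuity of Théorème 9

LINE 1 — LABEL: **RH-FREE** (Fourier/Mellin analysis of the Sonine spaces `K_λ`; the Riemann zeta
function does not occur). FRAMING (cell rh-crit, D-0074): corpus theorems are RH-FREE literature; nothing
here is worded as progress toward RH. bears_on: B-C/B-P (LADDER-RH COLUMN 6, de Branges framework) as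
corpus vocabulary. WHAT THIS IS NOT: not a route, not a criterion, no positivity condition at `E_ζ`;
clauses (iii)–(v) of Théorème 8 (Hermite–Biehler property of `ℰ_λ` and the isometry `ℬ(ℰ_λ) ≅ 𝒮_λ`) are
NOT proved here and the named fact `Burnol2002CRAS_thm8` stays open. Nothing here bears on the truth of RH.

Source. J.-F. Burnol, *Sur les « espaces de Sonine » associés par de Branges à la transformation de
Fourier*, C. R. Math. Acad. Sci. Paris **335** (2002) 689–692 = arXiv:math/0208121 [Burnol2002CRAS]
(TeX of record `rh-crit/dbl/src/Burnol2002CRAS_arXivmath0208121.tex`), Théorème 8 (TeX l.381–391):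
"`ℰ_λ(w) = π^{−w/2}Γ(w/2)(λ^{1/2−w} + (√λ/2)∫_λ^∞ (ψ_+^λ(t) − ψ_−^λ(t))t^{−w}dt)`. L'intégrale est
absolument convergente pour `Re(w) > 0`. La fonction `ℰ_λ(w)` est une fonction entière …".

## What is PROVED (theorems only; no definition, no new named fact)

* `norm_psiPlus_sub_psiMinus_le`: `|ψ_+^λ(t) − ψ_−^λ(t)| ≤ C_λ/|t|` on `ℝ ∖ {0}`. Proof: by Définition 2
  `ψ_+ − ψ_− = −∫_{[−λ,λ]}(h_+ + h_−)(y)e^{2πity}dy`, and `h_± = ψ_±` a.e. on `[−λ,λ]` (Théorème 7,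
  `psiPlus_eq_hPlus_ae`) with `ψ_±` ENTIRE (`differentiable_psiPlus`); one integration by parts.
* `Burnol2002CRAS_thm8_i` — clause (i) verbatim as typed in `Burnol2002CRAS_thm8`: for `λ > 0` and
  `Re w > 0`, `t ↦ (ψ_+^λ − ψ_−^λ)(t)t^{−w}` is integrable on `(λ,∞)`.
* `differentiableOn_sonineEFormula`: the printed formula is holomorphic on `Re w > 0` (dominated
  holomorphic parametric integral).
* `Burnol2002CRAS_thm8_ii` — clause (ii) verbatim: for `λ > 0` there is an entire `E` with the printed
  values on `Re w > 0` (`IsSonineE λ E`). Proof: glue the printed formula (holomorphic on `Re w > 0`)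
  with the explicit left-half-plane formula `√λ·Γ_ℝ(1−w)(C_λ(λ,w) + ½∫_λ^∞(ψ_+ − ψ_−)C_λ(·,w))` of
  `BurnolSonineEvaluatorJump.lean` (holomorphic on `Re w < 1`, `differentiableOn_jumpB`); they agree on
  the strip `1/2 < Re w < 1` (`jumpA_eq_jumpB`, both being `√λ ×` the jump of THE evaluator), hence on
  `0 < Re w < 1` by the identity theorem.
* `Burnol2002CRAS_thm9_nonvacuous`: consequently the hypotheses of the discharged Théorème 9 are met —
  for every `λ > 0` and `w` there are `E` with `IsSonineE λ E` and `Z` with `IsSonineZ λ w Z`.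

Deviation from the print (said once): Burnol obtains entirety from the structure of `K_λ` as a de
Branges space ("une étude plus poussée", TeX l.416–421); here it is the by-product of the two explicit
half-plane formulas for `√λ ×` jump. Clauses (iii)–(v) are untouched.
-/

noncomputable section

open _root_.MeasureTheory _root_.Complex _root_.Set _root_.Filter
open scoped Real Topology
open Literature.Analysis.DeBrangesSpaces.SonineMellin (cosKernel cosKernel_neg differentiable_cosKernel
  continuousOn_cosKernel)

namespace Literature.Analysis.DeBrangesSpaces

namespace Burnol2002

/-! ## The `O(1/t)` decay of `ψ_+^λ − ψ_−^λ` on the real line -/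

/-- `ψ_+ − ψ_− = −∫_{[−λ,λ]}(ψ_+ + ψ_−)(y)e^{2πity}dy` on `ℝ` (Définition 2 and `h_± = ψ_±` a.e. on
`[−λ,λ]`). [cite: Burnol2002CRAS, Définition 2 and Théorème 7 (TeX l.361–375)] -/
theorem psiPlus_sub_psiMinus_eq_neg_setIntegral {lam : ℝ} (hlam : 0 ≤ lam) (t : ℝ) :
    psiPlus lam t - psiMinus lam t =
      -∫ y in Icc (-lam) lam, (psiPlus lam y + psiMinus lam y) * cexp (2 * π * I * (t : ℂ) * y) := by
  have hc : Continuous fun y : ℝ ↦ cexp (2 * π * I * (t : ℂ) * y) := by fun_prop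
  have hiP : IntegrableOn (fun y : ℝ ↦ psiPlus lam y * cexp (2 * π * I * (t : ℂ) * y)) (Icc (-lam) lam) :=
    (((differentiable_psiPlus hlam).continuous.comp continuous_ofReal).mul hc).continuousOn.integrableOn_Icc
  have hiM : IntegrableOn (fun y : ℝ ↦ psiMinus lam y * cexp (2 * π * I * (t : ℂ) * y)) (Icc (-lam) lam) :=
    (((differentiable_psiMinus hlam).continuous.comp continuous_ofReal).mul hc).continuousOn.integrableOn_Icc
  have eP : ∫ y in Icc (-lam) lam, (hPlus lam : ℝ → ℂ) y * cexp (2 * π * I * (t : ℂ) * y) =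
      ∫ y in Icc (-lam) lam, psiPlus lam y * cexp (2 * π * I * (t : ℂ) * y) := by
    refine integral_congr_ae ?_
    rw [Filter.EventuallyEq, ae_restrict_iff' measurableSet_Icc]
    filter_upwards [psiPlus_eq_hPlus_ae lam] with y hy hyI
    rw [hy hyI]
  have eM : ∫ y in Icc (-lam) lam, (hMinus lam : ℝ → ℂ) y * cexp (2 * π * I * (t : ℂ) * y) =
      ∫ y in Icc (-lam) lam, psiMinus lam y * cexp (2 * π * I * (t : ℂ) * y) := by
    refine integral_congr_ae ?_
    rw [Filter.EventuallyEq, ae_restrict_iff' measurableSet_Icc]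
    filter_upwards [psiMinus_eq_hMinus_ae lam] with y hy hyI
    rw [hy hyI]
  have e : psiPlus lam t - psiMinus lam t =
      -((∫ y in Icc (-lam) lam, (hPlus lam : ℝ → ℂ) y * cexp (2 * π * I * (t : ℂ) * y)) +
        ∫ y in Icc (-lam) lam, (hMinus lam : ℝ → ℂ) y * cexp (2 * π * I * (t : ℂ) * y)) := by
    rw [psiPlus, psiMinus]; ring
  rw [e, eP, eM, ← integral_add hiP hiM]
  congr 1
  refine integral_congr_ae (Eventually.of_forall fun y ↦ ?_)
  ring

/-- **Integration by parts bound**: for an entire `n` and real `t ≠ 0`,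
`‖∫_{[−λ,λ]} n(y)e^{2πity}dy‖ ≤ (‖n(λ)‖ + ‖n(−λ)‖ + ∫_{−λ}^{λ}‖n'‖)/(2π|t|)` (`λ ≥ 0`). [folklore] -/
private theorem norm_setIntegral_mul_cexp_le {lam : ℝ} (hlam : 0 ≤ lam) {n : ℂ → ℂ}
    (hn : Differentiable ℂ n) {t : ℝ} (ht : t ≠ 0) :
    ‖∫ y in Icc (-lam) lam, n y * cexp (2 * π * I * (t : ℂ) * y)‖ ≤
      (‖n lam‖ + ‖n (-(lam : ℂ))‖ + ∫ y in (-lam)..lam, ‖deriv n y‖) / (2 * π * |t|) := by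
  set c : ℂ := 2 * π * I * (t : ℂ) with hc
  have hc0 : c ≠ 0 := by
    rw [hc]; exact mul_ne_zero (mul_ne_zero (by norm_num [Real.pi_ne_zero]) I_ne_zero)
      (ofReal_ne_zero.mpr ht)
  have hcn : ‖c‖ = 2 * π * |t| := by
    rw [hc, norm_mul, norm_mul, norm_mul, Complex.norm_I, Complex.norm_real, Real.norm_eq_abs]
    simp [abs_of_pos Real.pi_pos]
  -- the primitive `v(y) = e^{cy}/c`
  have hv : ∀ y : ℝ, HasDerivAt (fun y : ℝ ↦ cexp (c * y) / c) (cexp (c * y)) y := by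
    intro y
    have h1 : HasDerivAt (fun y : ℝ ↦ c * (y : ℂ)) (c * 1) y :=
      (hasDerivAt_id y).ofReal_comp.const_mul c
    have h2 := (h1.cexp).div_const c
    rw [mul_one, mul_div_assoc, div_self hc0, mul_one] at h2
    exact h2
  have hu : ∀ y : ℝ, HasDerivAt (fun y : ℝ ↦ n y) (deriv n y) y := fun y ↦
    (hn y).hasDerivAt.comp_ofReal
  have hcont_n : Continuous fun y : ℝ ↦ n y := hn.continuous.comp continuous_ofReal
  have hcont_n' : Continuous fun y : ℝ ↦ deriv n y :=
    ((hn.contDiff (n := 1)).continuous_deriv le_rfl).comp continuous_ofReal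
  have hcont_e : Continuous fun y : ℝ ↦ cexp (c * y) := by fun_prop
  have hibp := intervalIntegral.integral_mul_deriv_eq_deriv_mul (a := -lam) (b := lam)
    (u := fun y : ℝ ↦ n y) (u' := fun y : ℝ ↦ deriv n y)
    (v := fun y : ℝ ↦ cexp (c * y) / c) (v' := fun y : ℝ ↦ cexp (c * y))
    (fun y _ ↦ hu y) (fun y _ ↦ hv y) (hcont_n'.intervalIntegrable _ _) (hcont_e.intervalIntegrable _ _)
  -- the set integral over `Icc` is the interval integral
  have hI : ∫ y in Icc (-lam) lam, n y * cexp (2 * π * I * (t : ℂ) * y) =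
      ∫ y in (-lam)..lam, n y * cexp (c * y) := by
    rw [intervalIntegral.integral_of_le (by linarith), integral_Icc_eq_integral_Ioc]
  rw [hI, hibp]
  push_cast
  have hvn : ∀ y : ℝ, ‖cexp (c * y) / c‖ = 1 / (2 * π * |t|) := by
    intro y
    rw [norm_div, hcn, hc, show (2 * π * I * (t : ℂ) * (y : ℂ)) = ((2 * π * t * y : ℝ) : ℂ) * I by
      push_cast; ring, Complex.norm_exp_ofReal_mul_I]
  have hpos : 0 < 2 * π * |t| := by positivity
  have hb1 : ‖n lam * (cexp (c * lam) / c)‖ = ‖n lam‖ / (2 * π * |t|) := by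
    rw [norm_mul, hvn]; ring
  have hb2 : ‖n (-(lam : ℂ)) * (cexp (c * -(lam : ℂ)) / c)‖ = ‖n (-(lam : ℂ))‖ / (2 * π * |t|) := by
    have := hvn (-lam)
    push_cast at this
    rw [norm_mul, this]; ring
  have hb3 : ‖∫ y in (-lam)..lam, deriv n y * (cexp (c * y) / c)‖ ≤
      (∫ y in (-lam)..lam, ‖deriv n y‖) / (2 * π * |t|) := by
    calc ‖∫ y in (-lam)..lam, deriv n y * (cexp (c * y) / c)‖
        ≤ ∫ y in (-lam)..lam, ‖deriv n y * (cexp (c * y) / c)‖ :=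
          intervalIntegral.norm_integral_le_integral_norm (by linarith)
      _ = ∫ y in (-lam)..lam, ‖deriv n y‖ * (1 / (2 * π * |t|)) :=
          intervalIntegral.integral_congr fun y _ ↦ by simp only [norm_mul, hvn]
      _ = (∫ y in (-lam)..lam, ‖deriv n y‖) / (2 * π * |t|) := by
          rw [intervalIntegral.integral_mul_const]; ring
  calc ‖n lam * (cexp (c * lam) / c) - n (-(lam : ℂ)) * (cexp (c * -(lam : ℂ)) / c) -
        ∫ y in (-lam)..lam, deriv n y * (cexp (c * y) / c)‖
      ≤ ‖n lam * (cexp (c * lam) / c)‖ + ‖n (-(lam : ℂ)) * (cexp (c * -(lam : ℂ)) / c)‖ +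
          ‖∫ y in (-lam)..lam, deriv n y * (cexp (c * y) / c)‖ := by
        refine (norm_sub_le _ _).trans ?_
        gcongr
        exact norm_sub_le _ _
    _ ≤ ‖n lam‖ / (2 * π * |t|) + ‖n (-(lam : ℂ))‖ / (2 * π * |t|) +
          (∫ y in (-lam)..lam, ‖deriv n y‖) / (2 * π * |t|) := by rw [hb1, hb2]; linarith [hb3]
    _ = (‖n lam‖ + ‖n (-(lam : ℂ))‖ + ∫ y in (-lam)..lam, ‖deriv n y‖) / (2 * π * |t|) := by ring

/-- **`ψ_+^λ − ψ_−^λ = O(1/t)` on the real line**: there is `C` with `‖ψ_+^λ(t) − ψ_−^λ(t)‖ ≤ C/|t|`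
for every real `t ≠ 0` (`λ ≥ 0`; one integration by parts, `ψ_±` being entire). This is what makes the
integral of Théorème 8 absolutely convergent on `Re w > 0`. [cite: Burnol2002CRAS, Théorème 8 (TeX l.383–386)] -/
theorem norm_psiPlus_sub_psiMinus_le {lam : ℝ} (hlam : 0 ≤ lam) :
    ∃ C : ℝ, 0 ≤ C ∧ ∀ t : ℝ, t ≠ 0 → ‖psiPlus lam t - psiMinus lam t‖ ≤ C / |t| := by
  set n : ℂ → ℂ := fun z ↦ psiPlus lam z + psiMinus lam z with hn
  have hnd : Differentiable ℂ n := (differentiable_psiPlus hlam).add (differentiable_psiMinus hlam)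
  refine ⟨(‖n lam‖ + ‖n (-(lam : ℂ))‖ + ∫ y in (-lam)..lam, ‖deriv n y‖) / (2 * π), ?_,
    fun t ht ↦ ?_⟩
  · have : 0 ≤ ∫ y in (-lam)..lam, ‖deriv n y‖ :=
      intervalIntegral.integral_nonneg (by linarith) fun y _ ↦ norm_nonneg _
    positivity
  · rw [psiPlus_sub_psiMinus_eq_neg_setIntegral hlam, norm_neg]
    refine (norm_setIntegral_mul_cexp_le hlam hnd ht).trans (le_of_eq ?_)
    rw [div_div]

/-- **Théorème 8, clause (i), as typed**: for `λ > 0` and `Re w > 0` the function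
`t ↦ (ψ_+^λ(t) − ψ_−^λ(t))t^{−w}` is integrable on `(λ,∞)` ("L'intégrale est absolument convergente pour
`Re(w) > 0`"). [cite: Burnol2002CRAS, Théorème 8 (TeX l.383–386)] -/
theorem Burnol2002CRAS_thm8_i {lam : ℝ} (hlam : 0 < lam) {w : ℂ} (hw : 0 < w.re) :
    IntegrableOn (fun t : ℝ ↦ (psiPlus lam t - psiMinus lam t) * (t : ℂ) ^ (-w)) (Ioi lam) := by
  obtain ⟨C, hC0, hC⟩ := norm_psiPlus_sub_psiMinus_le hlam.le
  have hmeas : AEStronglyMeasurable (fun t : ℝ ↦ (psiPlus lam t - psiMinus lam t) * (t : ℂ) ^ (-w))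
      (volume.restrict (Ioi lam)) := by
    refine ContinuousOn.aestronglyMeasurable (fun t ht ↦ ?_) measurableSet_Ioi
    have ht0 : t ≠ 0 := (hlam.trans ht).ne'
    exact ((((differentiable_psiPlus hlam.le).continuous.comp continuous_ofReal).sub
      ((differentiable_psiMinus hlam.le).continuous.comp continuous_ofReal)).continuousAt.mul
      (continuousAt_ofReal_cpow_const _ _ (Or.inr ht0))).continuousWithinAt
  have hdom : IntegrableOn (fun t : ℝ ↦ C * t ^ (-(1 + w.re))) (Ioi lam) :=
    (integrableOn_Ioi_rpow_of_lt (by linarith) hlam).const_mul C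
  refine Integrable.mono' hdom hmeas ?_
  filter_upwards [ae_restrict_mem measurableSet_Ioi] with t ht
  have ht0 : 0 < t := hlam.trans ht
  rw [norm_mul, Complex.norm_cpow_eq_rpow_re_of_pos ht0, Complex.neg_re]
  calc ‖psiPlus lam t - psiMinus lam t‖ * t ^ (-w.re) ≤ C / |t| * t ^ (-w.re) := by
        gcongr; exact hC t ht0.ne'
    _ = C * t ^ (-(1 + w.re)) := by
        rw [abs_of_pos ht0, neg_add, Real.rpow_add ht0, Real.rpow_neg_one]
        ring

/-! ## The printed formula is holomorphic on `Re w > 0` -/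

/-- `Γ_ℝ` is complex differentiable wherever it does not vanish. [folklore] -/
private theorem differentiableAt_Gammaℝ'' {w : ℂ} (hw : Gammaℝ w ≠ 0) : DifferentiableAt ℂ Gammaℝ w := by
  have h1 : DifferentiableAt ℂ (fun s : ℂ ↦ ((Gammaℝ s)⁻¹)⁻¹) w :=
    differentiable_Gammaℝ_inv.differentiableAt.inv (inv_ne_zero hw)
  have heq : (fun s : ℂ ↦ ((Gammaℝ s)⁻¹)⁻¹) = Gammaℝ := funext fun s ↦ inv_inv _
  rwa [heq] at h1

/-- **The integral `w ↦ ∫_λ^∞ (ψ_+^λ − ψ_−^λ)(t)t^{−w}dt` is holomorphic on `Re w > 0`** (dominated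
holomorphic parametric integral: on `ε < Re w`, `‖w‖ < R` the integrand is bounded by
`C t^{−1}(t^{−ε} + t^{−R})`). [cite: Burnol2002CRAS, Théorème 8 (TeX l.383–387)] -/
theorem differentiableOn_integral_psi_cpow {lam : ℝ} (hlam : 0 < lam) :
    DifferentiableOn ℂ (fun w : ℂ ↦ ∫ t in Ioi lam, (psiPlus lam t - psiMinus lam t) * (t : ℂ) ^ (-w))
      {w : ℂ | 0 < w.re} := by
  obtain ⟨C, hC0, hC⟩ := norm_psiPlus_sub_psiMinus_le hlam.le
  intro w₀ hw₀
  set ε : ℝ := w₀.re / 2 with hε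
  have hε0 : 0 < ε := by simp only [hε, mem_setOf_eq] at hw₀ ⊢; linarith
  set R : ℝ := ‖w₀‖ + 1 with hR
  set U : Set ℂ := {w : ℂ | ε < w.re} ∩ Metric.ball 0 R with hU
  have hUo : IsOpen U := (isOpen_lt continuous_const Complex.continuous_re).inter Metric.isOpen_ball
  have hw₀U : w₀ ∈ U := by
    refine ⟨?_, ?_⟩
    · show ε < w₀.re; simp only [hε, mem_setOf_eq] at hw₀ ⊢; linarith
    · rw [Metric.mem_ball, dist_zero_right, hR]; linarith
  suffices h : DifferentiableOn ℂ
      (fun w : ℂ ↦ ∫ t in Ioi lam, (psiPlus lam t - psiMinus lam t) * (t : ℂ) ^ (-w)) U from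
    (h.differentiableAt (hUo.mem_nhds hw₀U)).differentiableWithinAt
  have hmcont : Continuous fun t : ℝ ↦ psiPlus lam t - psiMinus lam t :=
    ((differentiable_psiPlus hlam.le).continuous.comp continuous_ofReal).sub
      ((differentiable_psiMinus hlam.le).continuous.comp continuous_ofReal)
  refine Literature.Analysis.Fourier.differentiableOn_integral_of_dominated_holomorphic
    (μ := volume.restrict (Ioi lam))
    (K := fun w t ↦ (psiPlus lam t - psiMinus lam t) * (t : ℂ) ^ (-w))
    (B := fun t ↦ C * t ^ (-(1 : ℝ)) * (t ^ (-ε) + t ^ (-R))) hUo ?_ ?_ ?_ ?_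
  · intro w _
    refine ContinuousOn.aestronglyMeasurable (fun t ht ↦ ?_) measurableSet_Ioi
    exact (hmcont.continuousAt.mul
      (continuousAt_ofReal_cpow_const _ _ (Or.inr (hlam.trans ht).ne'))).continuousWithinAt
  · filter_upwards [ae_restrict_mem measurableSet_Ioi] with t ht
    have ht0 : (t : ℂ) ≠ 0 := ofReal_ne_zero.mpr (hlam.trans ht).ne'
    intro w _
    exact (((differentiableAt_id.neg).const_cpow (Or.inl ht0)).const_mul _).differentiableWithinAt
  · filter_upwards [ae_restrict_mem measurableSet_Ioi] with t ht w hw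
    have ht0 : 0 < t := hlam.trans ht
    obtain ⟨hwε, hwR⟩ := hw
    rw [Metric.mem_ball, dist_zero_right] at hwR
    rw [norm_mul, Complex.norm_cpow_eq_rpow_re_of_pos ht0, Complex.neg_re]
    have hre : -R ≤ -w.re ∧ -w.re ≤ -ε := by
      constructor
      · have := (abs_re_le_norm w); rw [abs_le] at this; linarith [this.1]
      · exact neg_le_neg (le_of_lt hwε)
    have hpow : t ^ (-w.re) ≤ t ^ (-ε) + t ^ (-R) := by
      rcases le_or_gt 1 t with h1 | h1
      · calc t ^ (-w.re) ≤ t ^ (-ε) := Real.rpow_le_rpow_of_exponent_le h1 hre.2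
          _ ≤ t ^ (-ε) + t ^ (-R) := le_add_of_nonneg_right (by positivity)
      · calc t ^ (-w.re) ≤ t ^ (-R) := Real.rpow_le_rpow_of_exponent_ge ht0 h1.le hre.1
          _ ≤ t ^ (-ε) + t ^ (-R) := le_add_of_nonneg_left (by positivity)
    calc ‖psiPlus lam t - psiMinus lam t‖ * t ^ (-w.re)
        ≤ C / |t| * (t ^ (-ε) + t ^ (-R)) := by
          gcongr
          · exact hC t ht0.ne'
      _ = C * t ^ (-(1 : ℝ)) * (t ^ (-ε) + t ^ (-R)) := by
          rw [abs_of_pos ht0, Real.rpow_neg_one]; ring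
  · have h1 : IntegrableOn (fun t : ℝ ↦ t ^ (-(1 : ℝ) + -ε)) (Ioi lam) :=
      integrableOn_Ioi_rpow_of_lt (by linarith) hlam
    have h2 : IntegrableOn (fun t : ℝ ↦ t ^ (-(1 : ℝ) + -R)) (Ioi lam) :=
      integrableOn_Ioi_rpow_of_lt (by rw [hR]; linarith [norm_nonneg w₀]) hlam
    have h3 : IntegrableOn (fun t : ℝ ↦ C * (t ^ (-(1 : ℝ) + -ε) + t ^ (-(1 : ℝ) + -R))) (Ioi lam) :=
      (h1.add h2).const_mul C
    refine h3.congr_fun (fun t ht ↦ ?_) measurableSet_Ioi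
    have ht0 : 0 < t := hlam.trans ht
    dsimp only
    rw [Real.rpow_add ht0, Real.rpow_add ht0]
    ring

/-- **The printed formula `sonineEFormula λ` is holomorphic on `Re w > 0`** (`Γ_ℝ`, `λ^{1/2−w}` and the
integral are). [cite: Burnol2002CRAS, Théorème 8 (TeX l.383–387)] -/
theorem differentiableOn_sonineEFormula {lam : ℝ} (hlam : 0 < lam) :
    DifferentiableOn ℂ (sonineEFormula lam) {w : ℂ | 0 < w.re} := by
  have hI := differentiableOn_integral_psi_cpow hlam
  intro w hw
  have hG : Gammaℝ w ≠ 0 := Gammaℝ_ne_zero_of_re_pos hw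
  have hlam0 : (lam : ℂ) ≠ 0 := ofReal_ne_zero.mpr hlam.ne'
  unfold sonineEFormula
  refine ((differentiableAt_Gammaℝ'' hG).differentiableWithinAt).mul ?_
  refine (((differentiableAt_const _).sub differentiableAt_id).const_cpow
    (Or.inl hlam0)).differentiableWithinAt.add ?_
  exact (hI w hw).const_mul _

/-! ## `ℰ_λ` is entire: clause (ii), and the non-vacuity of Théorème 9 -/

/-- **Théorème 8, clause (ii), as typed**: for `λ > 0` there is an ENTIRE function `ℰ` with the
printed values `sonineEFormula λ w` on `Re w > 0` ("La fonction `ℰ_λ(w)` est une fonction entière").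
The entire function is the glue of the printed formula (holomorphic on `Re w > 0`) with the explicit
left-half-plane formula `√λ·Γ_ℝ(1−w)(C_λ(λ,w) + ½∫_λ^∞ (ψ_+ − ψ_−)C_λ(·,w))` (holomorphic on
`Re w < 1`); both are `√λ ×` the jump of the evaluator `Z_w^λ` on the strip `1/2 < Re w < 1`.
[cite: Burnol2002CRAS, Théorème 8 (TeX l.383–387)] -/
theorem Burnol2002CRAS_thm8_ii {lam : ℝ} (hlam : 0 < lam) : ∃ E : ℂ → ℂ, IsSonineE lam E := by
  set E₀ : ℂ → ℂ := fun w ↦ (Real.sqrt lam : ℂ) * (Gammaℝ (1 - w) * (cosKernel lam lam w +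
      (1 / 2 : ℂ) * ∫ t in Ioi lam, (psiPlus lam t - psiMinus lam t) * cosKernel lam t w)) with hE₀
  set F₁ : ℂ → ℂ := sonineEFormula lam with hF₁
  set V₀ : Set ℂ := {w : ℂ | w.re < 1} with hV₀
  set V₁ : Set ℂ := {w : ℂ | 0 < w.re} with hV₁
  have hV₀o : IsOpen V₀ := isOpen_lt Complex.continuous_re continuous_const
  have hV₁o : IsOpen V₁ := isOpen_lt continuous_const Complex.continuous_re
  have hd₀ : DifferentiableOn ℂ E₀ V₀ := (differentiableOn_const _).mul (differentiableOn_jumpB hlam)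
  have hd₁ : DifferentiableOn ℂ F₁ V₁ := differentiableOn_sonineEFormula hlam
  -- agreement on the strip `1/2 < Re w < 1`, then on `0 < Re w < 1`
  have hstrip : ∀ z : ℂ, 1 / 2 < z.re → z.re < 1 → E₀ z = F₁ z := by
    intro z h1 h2
    rw [hE₀, hF₁]
    dsimp only
    rw [← jumpA_eq_jumpB hlam h1 h2, ← sonineEFormula_eq_sqrt_mul_jump hlam]
  have hagree : EqOn E₀ F₁ (V₀ ∩ V₁) := by
    have hWo : IsOpen (V₀ ∩ V₁) := hV₀o.inter hV₁o
    have hconn : IsPreconnected (V₀ ∩ V₁) := by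
      have : Convex ℝ (V₀ ∩ V₁) := (convex_halfSpace_re_lt (1 : ℝ)).inter (convex_halfSpace_re_gt (0 : ℝ))
      exact this.isPreconnected
    have h1 : AnalyticOnNhd ℂ E₀ (V₀ ∩ V₁) := (hd₀.mono inter_subset_left).analyticOnNhd hWo
    have h2 : AnalyticOnNhd ℂ F₁ (V₀ ∩ V₁) := (hd₁.mono inter_subset_right).analyticOnNhd hWo
    have hz₀ : (3 / 4 : ℂ) ∈ V₀ ∩ V₁ := by
      simp only [hV₀, hV₁, mem_inter_iff, mem_setOf_eq]; norm_num
    have hS : IsOpen {w : ℂ | 1 / 2 < w.re ∧ w.re < 1} :=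
      (isOpen_lt continuous_const Complex.continuous_re).inter
        (isOpen_lt Complex.continuous_re continuous_const)
    have hmem : (3 / 4 : ℂ) ∈ {w : ℂ | 1 / 2 < w.re ∧ w.re < 1} := by
      simp only [mem_setOf_eq]; norm_num
    have hev : E₀ =ᶠ[𝓝 (3 / 4 : ℂ)] F₁ := by
      filter_upwards [hS.mem_nhds hmem] with z hz
      exact hstrip z hz.1 hz.2
    exact h1.eqOn_of_preconnected_of_eventuallyEq h2 hconn hz₀ hev
  -- the glue
  refine ⟨fun w ↦ if w.re < 3 / 4 then E₀ w else F₁ w, ?_, ?_⟩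
  · intro w
    by_cases hw : w.re < 1
    · -- near `w` the glue is `E₀`
      have hev : (fun w ↦ if w.re < 3 / 4 then E₀ w else F₁ w) =ᶠ[𝓝 w] E₀ := by
        filter_upwards [hV₀o.mem_nhds (show w ∈ V₀ from hw)] with z hz
        by_cases hz' : z.re < 3 / 4
        · rw [if_pos hz']
        · rw [if_neg hz']
          exact (hagree ⟨hz, show (0 : ℝ) < z.re by linarith [not_lt.1 hz']⟩).symm
      exact ((hd₀.differentiableAt (hV₀o.mem_nhds hw)).congr_of_eventuallyEq hev)
    · have hw' : 0 < w.re := by linarith [not_lt.1 hw]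
      have hev : (fun w ↦ if w.re < 3 / 4 then E₀ w else F₁ w) =ᶠ[𝓝 w] F₁ := by
        filter_upwards [hV₁o.mem_nhds (show w ∈ V₁ from hw')] with z hz
        by_cases hz' : z.re < 3 / 4
        · rw [if_pos hz']
          exact hagree ⟨show z.re < 1 by linarith, hz⟩
        · rw [if_neg hz']
      exact ((hd₁.differentiableAt (hV₁o.mem_nhds hw')).congr_of_eventuallyEq hev)
  · intro w hw
    dsimp only
    by_cases hw' : w.re < 3 / 4
    · rw [if_pos hw']
      exact hagree ⟨show w.re < 1 by linarith, hw⟩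
    · rw [if_neg hw']

/-- **Non-vacuity of Théorème 9** (`Burnol2002CRAS_thm9_holds`): for every `λ > 0` and `w ∈ ℂ` there
ARE an entire `ℰ` with the printed values and an evaluator `Z_w^λ`, so the discharged statement speaks
about actual objects. [cite: Burnol2002CRAS, Théorèmes 8–9 (TeX l.381–391, 424–428)] -/
theorem Burnol2002CRAS_thm9_nonvacuous {lam : ℝ} (hlam : 0 < lam) (w : ℂ) :
    (∃ E : ℂ → ℂ, IsSonineE lam E) ∧ ∃ Z : Lp ℂ 2 (volume : Measure ℝ), IsSonineZ lam w Z := by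
  refine ⟨Burnol2002CRAS_thm8_ii hlam, ?_⟩
  by_cases hw : 1 / 2 < w.re
  · exact ⟨_, isSonineZ_reprA hlam hw⟩
  · have hG : Gammaℝ (1 - w) ≠ 0 := Gammaℝ_ne_zero_of_re_pos (by simp; linarith [not_lt.1 hw])
    exact ⟨_, isSonineZ_reprB hlam hG⟩

end Burnol2002

end Literature.Analysis.DeBrangesSpaces
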